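import Summits.BirchSwinnertonDyer.BirchSwinnertonDyer.Theorems.ClassRecordThreeEulerHalvesAtThreeCartanCoverCuspidalCochain
import Summits.BirchSwinnertonDyer.BirchSwinnertonDyer.Theorems.ClassRecordThreeEulerHalvesAtThreeCartanCoverChebotarevSupply
import Summits.BirchSwinnertonDyer.BirchSwinnertonDyer.Theorems.ClassRecordThreeEulerHalvesAtThreeCartanCoverResidueMapsAtGoodPrimes
import Summits.BirchSwinnertonDyer.BirchSwinnertonDyer.Theorems.ClassRecordThreeEulerHalvesAtThreeCartanCoverSimultaneousHeckeRepsHolds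
import Summits.BirchSwinnertonDyer.BirchSwinnertonDyer.Theorems.ClassRecordThreeEulerHalvesAtThreeCartanCarayolLift
import Literature.NumberTheory.Automorphic.ShimuraCurveCartanLevelHeckeDegree
import HarnessLib

/-!
# The inert-Hecke certificate for (OBS), part E — THE PACKAGE: (EIG′) `CartanCarayol.PeriodCharacterCuspidalEigenPackageAtThree` PROVED;
# hence (OBS) ⟸ Deligne ∧ (LIFT′)

Support file for crux `CartanOnePlaceDegreeLawAtThree` (NUM; item stmt-BirchSwinnertonDyer-24801; registered line `Lines/lattice`, Galois leaf (OBS)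
`CartanCover.Charext.NoModThreePeriodCharacterExtension`). LEAD bsd-stepL tam3-p1 g28. THE KERNEL GLUE of the inert-Hecke certificate (crux idea
`inert-hecke-elliptic-torsion`, cruxidea-24801-1 parts A–C; bsd-idea-10 g20's sockets (LIFT′)∕(EIG′), p742701, critic V214 PASS after the parabolic repair):

* `heckeCertificateAt` — at a good prime `ℓ ∤ q·D·M·∏_C p`, (SIMREP) (THEOREM `simultaneousHeckeReps_holds`, defn-ty1 g42 ∕ p743327) gives ONE Hecke datum serving
  `Γ̄(q) ≤ Γ ≤ ι(O₀'¹)`; the scaled period cochain `c·per_F` (`F = Q.form`, eigenvalue `a_ℓ(W₁)` by `Q.hecke_eq`) is eigen for the `Γ̄(q)`-restricted datum modulo `3Λ`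
  ((T11c′) + (T14c)), so (T12′) the reduced cochain `χ̄` is `T_ℓ`-eigen on ALL of `ι(O₀'¹)` with eigenvalue `a_ℓ(W₁)`, for a FULL representative system ((SIMREP) (iv)).
* `periodCharacterCuspidalEigenPackageAtThree_holds : CartanCarayol.PeriodCharacterCuspidalEigenPackageAtThree` — from the literal
  hypotheses of (CONG)∕(EIG′): (T14) `χ̄ = χ mod 3Λ` additive, `3`-torsion, non-zero on `Γ̄(q)`; eigen outside `S = primeFactors(q·D·M·∏_C p)`; NULL ON EVERY ELEMENT
  OF FINITE ORDER by the engine (parts D∕D′) at the Chebotarev prime `ℓ₀ ≡ 2 (3)`, `3 ∤ a_{ℓ₀}(V) = a_{ℓ₀}(W₁)` ((CHEB) THEOREM p741814; isogeny invariance; (RED_ℓ) THEOREM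
  p742978); NULL ON PARABOLIC ELEMENTS by part D′ with (PAR) the THEOREM `segmentIntegral_eq_zero_of_isParabolic` (`…CartanCoverParabolicPeriods`).
* `congruentNewform_of_cuspLift' : LIFT′ → CONG`, `noModThreePeriodCharacterExtension_of_cuspLift' : thm61 → LIFT′ → OBS`
  (bsd-idea-10's `congruentNewform_of_cuspLift` ∕ `noModThreePeriodCharacterExtension_of_cuspLift` BY NAME, fed with the package), `chebotarevSupplyAtThree_holds`.
So the Galois leaf (OBS) of `Lines/lattice` v8 is CLOSED MODULO: Deligne's theorem [tree named fact] and (LIFT′) [bsd-idea-10's print statement: torsion-free lift +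
Deligne–Serre (tree) + Eichler–Shimura `H¹_P` + Jacquet–Langlands] — `Lines/lattice` v12.
HONEST: sorry-free implications between named `Prop`s; nothing is proved about any curve's `L`-value; OBS ∕ 24801 ∕ 23422 ∕ 19109 open; BSD is proved for no curve.
-/

set_option linter.dupNamespace false
set_option autoImplicit false

noncomputable section

open scoped Classical MatrixGroups NumberField

namespace Summit.BirchSwinnertonDyer.BirchSwinnertonDyer.Theorems.CartanCover.Charext.InertHecke

open Literature.NumberTheory.Automorphic Literature.NumberTheory.EllipticCurves
  Literature.NumberTheory.EllipticCurves.Rank1Residual WeierstrassCurve Literature.NumberTheory.EllipticCurves.ModularForms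

section Assembly

variable {D M : ℕ} {C : Finset ℕ} (X : CartanLevelCurveData D M C)

/-- **The Hecke certificate at one good prime.** For `q ∈ C`, `q ≠ 3`, a reduction datum `R` at `q`, parametrisation data `Q` of `W₁` on `X`, a prime
`ℓ ∤ q·D·M·∏_C p` and a `3`-torsion additive cochain `χ̄` on `ι(O₀'¹)` agreeing on `Γ̄(q)` with `c·per_F mod 3Λ` (`F = Q.form`, `Λ = Λ(W₁)`): (SIMREP) — the THEOREM `simultaneousHeckeReps_holds` (defn-ty1 g42, p743327) — yields
`Γ`-elements `g` whose translates `g_i · q_i.out` are `ι(O₀'¹)`-inequivalent (`disjU`), right-stable (`stabU`) and serve `Γ̄(q)` (`memN`), such that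
(a) `c·per̄_F` is eigen for the `Γ̄(q)`-restricted datum with eigenvalue `a_ℓ(W₁)` ((T11c′) via `Q.hecke_eq`, read mod `3Λ` by (T14c)); (b) the representatives
lie in `ι(O₀'(ℓ))` (`X.O ⊆ O₀'`); (c) they meet every `ι(O₀'¹)`-coset of `ι(O₀'(ℓ))`; (d) (T12′) `T_ℓ χ̄ = a_ℓ(W₁) • χ̄` on all of `ι(O₀'¹)`.
[cite: ShimuraIATAF1971, §8.3 (8.3.2) and Prop. 3.36] -/
theorem heckeCertificateAt {q : ℕ} [Fact q.Prime] (hq : q ∈ C) (hq3 : q ≠ 3) (R : CartanCover.CoverReduction X q)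
    {W₁ : WeierstrassCurve ℚ} [W₁.IsElliptic] (Q : CartanParametrizationData X W₁) (c : ℂ)
    {ℓ : ℕ} (hℓ : ℓ.Prime) (hℓbad : ¬ ℓ ∣ q * (D * M * ∏ p ∈ C, p)) [Fintype (Quotient (X.heckeSetoid ℓ))]
    (χb : CartanCover.coverUnits X q → ℂ ⧸ threeMul Q.L.lattice) (hχb : ∀ a b, χb (a * b) = χb a + χb b) (h3 : ∀ u, 3 • χb u = 0)
    (hagree : ∀ (β : GL (Fin 2) ℝ) (hβ : β ∈ CartanCover.principalLevel X q),
      χb ⟨β, CartanCover.principalLevel_le_coverUnits X q hβ⟩ =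
        redThree Q.L.lattice (c * segmentIntegral (⇑Q.form) Q.basePoint (β • Q.basePoint))) :
    ∃ (g : Quotient (X.heckeSetoid ℓ) → X.Gamma)
      (disjU : ∀ (i j : Quotient (X.heckeSetoid ℓ)) (u : GL (Fin 2) ℝ), u ∈ CartanCover.coverUnits X q →
        ((gammaHeckeDatum X ℓ).changeReps g).α i = u * ((gammaHeckeDatum X ℓ).changeReps g).α j → i = j)
      (stabU : ∀ (u : CartanCover.coverUnits X q) (i : Quotient (X.heckeSetoid ℓ)), ∃ j,
        ((gammaHeckeDatum X ℓ).changeReps g).α i * u * (((gammaHeckeDatum X ℓ).changeReps g).α j)⁻¹ ∈ CartanCover.coverUnits X q)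
      (memN : ∀ (β : CartanCover.principalLevel X q) (i : Quotient (X.heckeSetoid ℓ)),
        ((gammaHeckeDatum X ℓ).changeReps g).α i * β *
          (((gammaHeckeDatum X ℓ).changeReps g).α
            (((gammaHeckeDatum X ℓ).changeReps g).σ ⟨β, CartanCover.principalLevel_le_Gamma X q hq β.2⟩ i))⁻¹ ∈ CartanCover.principalLevel X q),
      (∀ β : CartanCover.principalLevel X q,
        (((gammaHeckeDatum X ℓ).changeReps g).restrict (CartanCover.principalLevel X q) (CartanCover.principalLevel_le_Gamma X q hq) memN).op
            (fun δ : CartanCover.principalLevel X q =>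
              redThree Q.L.lattice (c * segmentIntegral (⇑Q.form) Q.basePoint ((δ : GL (Fin 2) ℝ) • Q.basePoint))) β
          = (W₁.LFunction ℓ : ℤ) • redThree Q.L.lattice (c * segmentIntegral (⇑Q.form) Q.basePoint ((β : GL (Fin 2) ℝ) • Q.basePoint))) ∧
      (∀ i, (HeckeDatum.ofStable (Γ := CartanCover.coverUnits X q) ((gammaHeckeDatum X ℓ).changeReps g).α disjU stabU).α i ∈
        unitsHeckeSet X.ι (O := CartanCover.coverOrder X q) ℓ) ∧
      (∀ a ∈ unitsHeckeSet X.ι (O := CartanCover.coverOrder X q) ℓ, ∃ i, ∃ u ∈ CartanCover.coverUnits X q,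
        u * a = (HeckeDatum.ofStable (Γ := CartanCover.coverUnits X q) ((gammaHeckeDatum X ℓ).changeReps g).α disjU stabU).α i) ∧
      (∀ u, (HeckeDatum.ofStable (Γ := CartanCover.coverUnits X q) ((gammaHeckeDatum X ℓ).changeReps g).α disjU stabU).op χb u =
        (W₁.LFunction ℓ : ℤ) • χb u) := by
  classical
  have hℓDMC : ¬ ℓ ∣ D * M * ∏ p ∈ C, p := fun h => hℓbad (dvd_mul_of_dvd_right h q)
  obtain ⟨g₀, hg₀, hdisj, hstab, hcrit, hcov⟩ := simultaneousHeckeReps_holds D M C X q hq ℓ hℓ hℓbad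
  let g : Quotient (X.heckeSetoid ℓ) → X.Gamma := fun i => ⟨g₀ i, hg₀ i⟩
  have hα : ∀ i, ((gammaHeckeDatum X ℓ).changeReps g).α i = g₀ i * ((i.out : X.heckeSet ℓ) : GL (Fin 2) ℝ) := by
    intro i
    show ((g i : X.Gamma) : GL (Fin 2) ℝ) * (gammaHeckeDatum X ℓ).α i = _
    rw [gammaHeckeDatum_α]
  have disjU : ∀ (i j : Quotient (X.heckeSetoid ℓ)) (u : GL (Fin 2) ℝ), u ∈ CartanCover.coverUnits X q →
      ((gammaHeckeDatum X ℓ).changeReps g).α i = u * ((gammaHeckeDatum X ℓ).changeReps g).α j → i = j := by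
    intro i j u hu h
    rw [hα, hα] at h
    exact hdisj i j u hu h
  have stabU : ∀ (u : CartanCover.coverUnits X q) (i : Quotient (X.heckeSetoid ℓ)), ∃ j,
      ((gammaHeckeDatum X ℓ).changeReps g).α i * u * (((gammaHeckeDatum X ℓ).changeReps g).α j)⁻¹ ∈ CartanCover.coverUnits X q := by
    intro u i
    obtain ⟨j, hj⟩ := hstab u u.2 i
    exact ⟨j, by rw [hα, hα]; exact hj⟩
  have memN : ∀ (β : CartanCover.principalLevel X q) (i : Quotient (X.heckeSetoid ℓ)),
      ((gammaHeckeDatum X ℓ).changeReps g).α i * β *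
        (((gammaHeckeDatum X ℓ).changeReps g).α
          (((gammaHeckeDatum X ℓ).changeReps g).σ ⟨β, CartanCover.principalLevel_le_Gamma X q hq β.2⟩ i))⁻¹ ∈ CartanCover.principalLevel X q := by
    intro β i
    refine ((gammaHeckeDatum X ℓ).changeReps g).memN_of_criterion (CartanCover.principalLevel X q)
      (CartanCover.principalLevel_le_Gamma X q hq) ?_ β β.2 i
    intro β' hβ' i' j' h
    rw [hα, hα] at h ⊢
    exact hcrit β' hβ' i' j' h
  -- (a) the scaled period cochain is eigen for the restricted datum, modulo `3Λ`
  set a : ℤ := W₁.LFunction ℓ with ha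
  have hhecke : X.heckeFun ℓ Q.form = fun τ => ((a : ℤ) : ℂ) * Q.form τ := Q.hecke_eq ℓ hℓ hℓDMC
  have heig : ∀ β : CartanCover.principalLevel X q,
      (((gammaHeckeDatum X ℓ).changeReps g).restrict (CartanCover.principalLevel X q) (CartanCover.principalLevel_le_Gamma X q hq) memN).op
          (fun δ : CartanCover.principalLevel X q =>
            redThree Q.L.lattice (c * segmentIntegral (⇑Q.form) Q.basePoint ((δ : GL (Fin 2) ℝ) • Q.basePoint))) β
        = a • redThree Q.L.lattice (c * segmentIntegral (⇑Q.form) Q.basePoint ((β : GL (Fin 2) ℝ) • Q.basePoint)) := by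
    intro β
    apply redThree_op_eq_smul Q.L.lattice _ (fun δ : CartanCover.principalLevel X q =>
      c * segmentIntegral (⇑Q.form) Q.basePoint ((δ : GL (Fin 2) ℝ) • Q.basePoint)) a β
    have h := period_op_restrict_eq_smul X hq ℓ Q.form ((a : ℤ) : ℂ) hhecke Q.basePoint g memN β
    rw [HeckeDatum.op_apply] at h ⊢
    simp only at h ⊢
    rw [← Finset.mul_sum, h]
    ring
  refine ⟨g, disjU, stabU, memN, heig, ?_, ?_, ?_⟩
  · -- (b) representatives in `ι(O₀'(ℓ))`
    intro i
    rw [HeckeDatum.ofStable_α, hα]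
    obtain ⟨⟨xg, hxg, hxgι⟩, -, hgdet⟩ := hg₀ i
    obtain ⟨⟨xo, hxo, hxoι⟩, hodet⟩ := (i.out : X.heckeSet ℓ).2
    refine ⟨⟨xg * xo, (CartanCover.isOrder_coverOrder X q).mul_mem _ (CartanCover.le_coverOrder X q hxg) _
      (CartanCover.le_coverOrder X q hxo), ?_⟩, ?_⟩
    · rw [map_mul, hxgι, hxoι, Units.val_mul]
    · rw [Units.val_mul, Matrix.det_mul, ← Matrix.GeneralLinearGroup.val_det_apply, hgdet, Units.val_one, one_mul, hodet]
  · -- (c) coverage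
    intro x hx
    obtain ⟨i, u, hu, h⟩ := hcov x hx
    exact ⟨i, u, hu, by rw [HeckeDatum.ofStable_α, hα]; exact h⟩
  · -- (d) (T12′)
    exact cover_op_eq_smul_of_agree_on X hq hq3 R ℓ g disjU stabU memN χb hχb h3
      (fun δ : CartanCover.principalLevel X q =>
        redThree Q.L.lattice (c * segmentIntegral (⇑Q.form) Q.basePoint ((δ : GL (Fin 2) ℝ) • Q.basePoint)))
      (fun β hβ => hagree β hβ) a heig

end Assembly

/-- **(EIG′) FROM THE CERTIFICATE — PROVED.** `CartanCarayol.PeriodCharacterCuspidalEigenPackageAtThree`: from the literal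
hypotheses of (CONG) — a `Λ`-valued function `χ` on `ι(O₀'¹)`, additive modulo `3Λ`, congruent to `c·per_F` on `Γ̄(q)`, with `c·per_F(Γ̄(q)) ⊄ 3Λ` — the package
`A := ℂ ∕ 3Λ`, `χ̄ := χ mod 3Λ`, `S := primeFactors(q·D·M·∏_C p)`: additive and `3`-torsion ((T14a)), non-zero (the negated conclusion read through (T14b) and
`redThree_eq_zero_iff`), null on every element of finite order (`apply_eq_zero_of_isOfFinOrder` at the Chebotarev prime supplied by the THEOREM (CHEB), with the residue map
(RED_ℓ) and the datum of `heckeCertificateAt`), null on parabolic elements (`apply_eq_zero_of_isParabolic`, (PAR) a theorem), and `T_ℓ`-eigen for a full representative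
system at every prime `ℓ ∉ S` (`heckeCertificateAt`). [cite: DiamondTaylor1994, Thm. 1 and §1] [cite: ShimuraIATAF1971, §8.3 (8.3.2) and Prop. 3.36] -/
theorem periodCharacterCuspidalEigenPackageAtThree_holds : CartanCarayol.PeriodCharacterCuspidalEigenPackageAtThree := by
  intro V _ hS N D M C q _ X W₁ _ Q hq hN hDMC hq3 hmin c χ hχΛ hχadd hχres hne
  classical
  -- the reduced cochain `χ̄` and its comparison with `c·per̄_F` on `Γ̄(q)`
  obtain ⟨hχb, h3⟩ := redThree_cochain Q.L.lattice (CartanCover.coverUnits X q) χ hχΛ hχadd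
  set χb : CartanCover.coverUnits X q → ℂ ⧸ threeMul Q.L.lattice := fun u => redThree Q.L.lattice (χ u) with hχbdef
  have hagree : ∀ (β : GL (Fin 2) ℝ) (hβ : β ∈ CartanCover.principalLevel X q),
      χb ⟨β, CartanCover.principalLevel_le_coverUnits X q hβ⟩ =
        redThree Q.L.lattice (c * segmentIntegral (⇑Q.form) Q.basePoint (β • Q.basePoint)) :=
    fun β hβ => redThree_eq_of_congr Q.L.lattice (hχres β hβ)
  have hne' : ∃ u, χb u ≠ 0 := by
    by_contra h0
    push Not at h0
    apply hne
    intro β hβ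
    have h := hagree β hβ
    rw [h0] at h
    exact (redThree_eq_zero_iff Q.L.lattice).mp h.symm
  obtain ⟨R⟩ := CartanTransport.Cover.coverReductionExists D M C X q hq
  -- the exceptional set
  have hq0 : q ≠ 0 := (Fact.out : q.Prime).ne_zero
  have hDM : D * M ≠ 0 := fun h => (X.coprime q hq).2 (by rw [h]; exact dvd_zero q)
  have hC : ∏ p ∈ C, p ≠ 0 := Finset.prod_ne_zero_iff.mpr fun p hp => (X.coprime p hp).1.ne_zero
  have hne0 : q * (D * M * ∏ p ∈ C, p) ≠ 0 := mul_ne_zero hq0 (mul_ne_zero hDM hC)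
  refine ⟨ℂ ⧸ threeMul Q.L.lattice, inferInstance, χb, (q * (D * M * ∏ p ∈ C, p)).primeFactors, hχb, h3, hne', ?_, ?_, ?_⟩
  · -- null on every element of finite order: the engine at the Chebotarev prime
    have hfinS : ({p : ℕ | p ∣ q * (D * M * ∏ p ∈ C, p)} : Set ℕ).Finite :=
      (Set.finite_le_nat (q * (D * M * ∏ p ∈ C, p))).subset fun p hp =>
        Set.mem_setOf.mpr (Nat.le_of_dvd (Nat.pos_of_ne_zero hne0) hp)
    obtain ⟨ℓ, hℓ, hℓS, -, hℓmod, hndvd⟩ :=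
      exists_prime_mod_three_eq_two_not_three_dvd_lFunction_of_surj V hS {p : ℕ | p ∣ q * (D * M * ∏ p ∈ C, p)} hfinS
    have hℓbad : ¬ ℓ ∣ q * (D * M * ∏ p ∈ C, p) := hℓS
    have hℓDMC : ¬ ℓ ∣ D * M * ∏ p ∈ C, p := fun h => hℓbad (dvd_mul_of_dvd_right h q)
    haveI : Fact ℓ.Prime := ⟨hℓ⟩
    obtain ⟨hfin, -⟩ := cartanLevel_card_heckeCosets_eq_holds D M C X ℓ hℓ hℓDMC
    letI : Fintype (Quotient (X.heckeSetoid ℓ)) := Fintype.ofFinite _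
    obtain ⟨g, disjU, stabU, memN, heig, -, -, -⟩ := heckeCertificateAt X hq hq3 R Q c hℓ hℓbad χb hχb h3 hagree
    obtain ⟨red, hred0, hdet⟩ := exists_coverResidueMap_of_not_dvd X q hℓ hℓbad
    have ha : ¬ (3 : ℤ) ∣ W₁.LFunction ℓ := by
      rw [← LFunction_eq_of_isIsogenous_holds V W₁ hmin.1]
      exact hndvd
    exact apply_eq_zero_of_isOfFinOrder X hq hq3 R hℓmod red hred0 hdet g disjU stabU memN χb hχb h3
      (fun δ : CartanCover.principalLevel X q =>
        redThree Q.L.lattice (c * segmentIntegral (⇑Q.form) Q.basePoint ((δ : GL (Fin 2) ℝ) • Q.basePoint)))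
      (fun β hβ => hagree β hβ) (W₁.LFunction ℓ) ha heig
  · -- null on parabolic elements, granted (PAR)
    intro u hu
    exact apply_eq_zero_of_isParabolic X hq hq3 Q c χb hχb h3 hagree u hu
  · -- eigen outside `S`
    intro ℓ hℓ hℓS
    have hℓbad : ¬ ℓ ∣ q * (D * M * ∏ p ∈ C, p) := fun h => hℓS (Nat.mem_primeFactors.mpr ⟨hℓ, h, hne0⟩)
    have hℓDMC : ¬ ℓ ∣ D * M * ∏ p ∈ C, p := fun h => hℓbad (dvd_mul_of_dvd_right h q)
    obtain ⟨hfin, -⟩ := cartanLevel_card_heckeCosets_eq_holds D M C X ℓ hℓ hℓDMC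
    letI : Fintype (Quotient (X.heckeSetoid ℓ)) := Fintype.ofFinite _
    obtain ⟨g, disjU, stabU, memN, -, hmem, hcov, hop⟩ := heckeCertificateAt X hq hq3 R Q c hℓ hℓbad χb hχb h3 hagree
    exact ⟨Quotient (X.heckeSetoid ℓ), inferInstance, _, hmem, hcov, hop⟩

/-- **(CONG) granted (LIFT′)** — bsd-idea-10's `congruentNewform_of_cuspLift` fed with the PROVED package. [cite: DiamondTaylor1994, Thm. 1 and §1] -/
theorem congruentNewform_of_cuspLift' (hLIFT : CartanCarayol.CuspidalEigenCochainLiftPrimeToCartanPlaceAtThree) :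
    CartanCarayol.CongruentNewformOfLevelPrimeToCartanPlaceAtThree :=
  CartanCarayol.congruentNewform_of_cuspLift hLIFT periodCharacterCuspidalEigenPackageAtThree_holds

/-- **(OBS) granted Deligne's theorem and (LIFT′)**: the Galois leaf of `Lines/lattice` follows (bsd-idea-10's `noModThreePeriodCharacterExtension_of_cuspLift`:
CONG ⇒ MOD ⇒ `ρ̄_{V,3}` unramified at the ADDITIVE place `q` — impossible). [cite: DeligneSerre1974, Thm. 6.1 and Lemme 6.11] [cite: Carayol1986, Thm. (A)]
[cite: DiamondTaylor1994, Thm. 1 and §1] -/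
theorem noModThreePeriodCharacterExtension_of_cuspLift' (h61 : DeligneSerre1974.thm61_exists_adicGaloisRep)
    (hLIFT : CartanCarayol.CuspidalEigenCochainLiftPrimeToCartanPlaceAtThree) : CartanCover.Charext.NoModThreePeriodCharacterExtension :=
  CartanCarayol.noModThreePeriodCharacterExtension_of_cuspLift h61 hLIFT periodCharacterCuspidalEigenPackageAtThree_holds

/-- **(CHEB) in the certificate's named shape**: `ChebotarevSupplyAtThree` (part C) holds (`chebotarevSupplyAtThree_unfolded`, p741814).
[cite: Serre1981, §8.1 eq. (238) (p. 188)] -/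
theorem chebotarevSupplyAtThree_holds : ChebotarevSupplyAtThree :=
  fun W _ h S hS => chebotarevSupplyAtThree_unfolded W h S hS

end Summit.BirchSwinnertonDyer.BirchSwinnertonDyer.Theorems.CartanCover.Charext.InertHecke

end
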